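import Mathlib
import HarnessLib
import Literature.Probability.LatticeModels.IsingLimitLaw
import Literature.Analysis.Complex.PolyaBesselKernel

/-!
# Crux `LeeYang.LeeyangPolyaKernelIsingLimit` (stmt-RiemannHypothesis-0453): objects of the line `telegraph-bessel-chain`

Route `RiemannHypothesis/LeeYang`, crux `LeeyangPolyaKernelIsingLimit` (item stmt-RiemannHypothesis-0453:
the law `∝ cosh(9u/2) e^{−2π cosh 2u} du` — Pólya's kernel — is an Ising limit law,
`Literature.Probability.LatticeModels.IsIsingLimitLaw`). Definitions (NO proofs of stubs) shared by
the checked skeleton `Cruxes/LeeyangPolyaKernelIsingLimit/Lines/Sketch.lean` (lead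
`prover-line-stmt-RiemannHypothesis-0453-0`), its registered stubs
(`Theorems/LeeYangLeeyangPolyaKernelIsingLimit<Stub>.lean`, `--supports stmt-RiemannHypothesis-0453`) and
the composition theorem, so that all positive-side files of this crux use ONE set of fully-qualified
names (`Lines/` is never imported).

## The line (idea cards `Ideas/telegraph-bessel-chain.md`, `Ideas/bessel-telegraph-chain.md`, `Ideas/ghost-spin-universal-factor.md`)

Write `t = log(s/a)`, `v = a e^t`. The ±1 telegraph process in logarithmic time with flip rate
`r_a(t) = v K₁(v)/K₀(v)` (the Doob transform by the positive solution `K₀(ae^t)` of `h″ = v² h`)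
has `E exp(z ∫₀^∞ σ dt) = K_z(a)/K₀(a)`, i.e. the law of `∫₀^∞ σ dt` is Pólya's kernel law
`e^{−a cosh u} du / 2K₀(a)`: the backward equations of `S = φ₊ + φ₋`, `D = φ₊ − φ₋` are
`S′ = −zD`, `D′ = −zS + 2rD`, and `S = 2K_z(ae^t)/K₀(ae^t)` is the solution with `S(∞) = 2`,
`D(∞) = 0`. An open nearest-neighbour FERROMAGNETIC Ising chain with uniform weights `η` and bond
`m` coupling `K_m = artanh e^{−2η r(t_{m+1})} ≥ 0` is exactly the two-state Markov chain with flip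
probabilities `(1 − e^{−2ηr})/2`, and its Laplace transform is the `2 × 2` transfer recursion
`sdIter` below — the explicit Euler scheme of that linear system, a product of CONTRACTIONS for
`z = iy`. Weak convergence then follows from Lévy's continuity theorem, the uniform
Gaussian-exponential moments from a cone invariant of the same recursion at real `z = h`
(`E e^{hM} ≤ 2 exp(h log(1 + 2h/a) + 3h + o(1)h²)`), and the factor `cosh(9u/2)` is one ghost spin
of weight `0` (closure of `IsIsingLimitLaw` under `cosh`-tilts).

In this file (definitions only; every docstring says what the object is):

* `chainJ`, `couplingOfTanh`, `sdStep`, `sdIter` — open chains on `Fin N` with nearest-neighbour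
  couplings, the coupling with prescribed `tanh`, and the transfer recursion in the `(S, D)` basis;
* `besselRatio v = K₁(v)/K₀(v)` (as `Re G₁(v,0)/Re G₀(v,0)` with the tree's
  `Literature.Analysis.Complex.Polya1926.polyaG`), `flipRate a t = a e^t · besselRatio (a e^t)`,
  `solS`, `solD` — the continuum solution `S = 2 G₀(ae^t, y)/G₀(ae^t, 0)`, `D = −S′/(iy)`;
* `horizon k = log(k+2)`, `nBonds k = (k+2)^5`, `mesh k = horizon k / nBonds k`, `siteTime k m`,
  `bondTanh a k m`, `chainK a k m` — the witness sequence of chains (site `m` of chain `k` sits at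
  logarithmic time `(nBonds k − m) · mesh k`; site `0` is the far end `t = horizon k`);
* `kernelMeasure a κ` — the law `∝ e^{−a cosh(κu)} du` as a measure; the line's `C⁺` is
  "`kernelMeasure a κ` is an Ising limit law" (the crux is `a = 2π`, `κ = 2` followed by the
  `cosh(9u/2)`-tilt).

References: G. Pólya, Acta Math. 48 (1926) 305–317 (the kernel and `K_z(a)`); M. Kac, Rocky
Mountain J. Math. 4 (1974) 497–509 (telegraph process, `2 × 2` backward system); R. B. Griffiths,
J. Math. Phys. 8 (1967) 484 (ghost spin); C. M. Newman, CPAM 27 (1974) 143–159 (closure of the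
Lee–Yang class). No statement of the literature is vendored here.
-/

noncomputable section

namespace Summit.RiemannHypothesis.RiemannHypothesis.Theorems.LeeYangTelegraph

open MeasureTheory Literature.Probability.LatticeModels Literature.Analysis.Complex.Polya1926

/-! ### Open Ising chains and the `2 × 2` transfer recursion -/

/-- Nearest-neighbour couplings of an OPEN chain on `Fin N`: sites `m` and `m + 1` are coupled by
`K m`, split symmetrically (`J_{m,m+1} = J_{m+1,m} = K m / 2`, so that the tree's double sum
`Σᵢⱼ Jᵢⱼ sᵢ sⱼ` contributes `K m · s_m s_{m+1}`); all other entries vanish. [folklore] -/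
def chainJ (N : ℕ) (K : ℕ → ℝ) (i j : Fin N) : ℝ :=
  if j.val = i.val + 1 then K i.val / 2 else if i.val = j.val + 1 then K j.val / 2 else 0

/-- The coupling `K = ½ log((1 + c)/(1 − c)) = artanh c` with `tanh K = c` (`|c| < 1`); for
`c ∈ [0, 1)` it is `≥ 0` (ferromagnetic). [folklore] -/
def couplingOfTanh (c : ℝ) : ℝ :=
  Real.log ((1 + c) / (1 - c)) / 2

/-- One step of the transfer recursion in the `(S, D)` basis: `X ↦ R(x) · diag(1, c) · X` with the
(hyperbolic) rotation `R(x) = [[cosh x, sinh x], [sinh x, cosh x]]`; here `x = z ·(weight)` and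
`c = tanh(coupling)`. For `x ∈ iℝ` and `|c| ≤ 1` it is a contraction of `|S|² + |D|²`. [folklore] -/
def sdStep (x : ℂ) (c : ℝ) (X : ℂ × ℂ) : ℂ × ℂ :=
  (Complex.cosh x * X.1 + c * Complex.sinh x * X.2, Complex.sinh x * X.1 + c * Complex.cosh x * X.2)

/-- The transfer recursion of an open chain with weights `w m` and bond parameters `c m`
(`= tanh` of the coupling of sites `m`, `m + 1`), read from site `0`:
`X₀ = (2 cosh(z w₀), 2 sinh(z w₀))`, `X_{m+1} = sdStep (z w_{m+1}) (c m) X_m`. The Laplace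
transform at `z` of the magnetization law of the chain on sites `0, …, N` is `(X_N).1 / 2`
(stub `stub_transfer` of the skeleton). [folklore] -/
def sdIter (z : ℂ) (w c : ℕ → ℝ) : ℕ → ℂ × ℂ
  | 0 => (2 * Complex.cosh (z * w 0), 2 * Complex.sinh (z * w 0))
  | m + 1 => sdStep (z * w (m + 1)) (c m) (sdIter z w c m)

/-! ### The Bessel flip rate and the continuum solution -/

/-- `q(v) = K₁(v)/K₀(v) = ∫ cosh t · e^{−v cosh t} dt / ∫ e^{−v cosh t} dt`, written with the
tree's `G_n(v, w) = ∫ cosh(t)^n e^{−v cosh t} e^{iwt} dt` at `w = 0` (both real and positive for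
`v > 0`). [folklore] -/
def besselRatio (v : ℝ) : ℝ :=
  (polyaG 1 v 0).re / (polyaG 0 v 0).re

/-- The telegraph flip rate in logarithmic time `t` (`v = a e^t`): `r_a(t) = v · K₁(v)/K₀(v)
= −(d/dt) log K₀(a e^t)`; it satisfies the Riccati equation `r′ = r² − v²` and `v ≤ r ≤ q(a) v`
for `t ≥ 0`. [folklore] -/
def flipRate (a t : ℝ) : ℝ :=
  a * Real.exp t * besselRatio (a * Real.exp t)

/-- The continuum solution `S_{a,y}(t) = 2 G₀(ae^t, y) / G₀(ae^t, 0) = 2 K_{iy}(ae^t)/K₀(ae^t)`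
(`= E[e^{iyM_t} | +] + E[e^{iyM_t} | −]` for the telegraph process); `S(∞) = 2`. [folklore] -/
def solS (a y t : ℝ) : ℂ :=
  2 * polyaG 0 (a * Real.exp t) y / polyaG 0 (a * Real.exp t) 0

/-- The continuum solution `D_{a,y}(t) = −S′(t)/(iy)
= (2iv/y) · (G₀(v,y) G₁(v,0) − G₁(v,y) G₀(v,0)) / G₀(v,0)²`, `v = ae^t` (junk-free at `y = 0`:
there `D ≡ 0`, which is the correct value). Together `S′ = −iy D`, `D′ = −iy S + 2 r D`.
[folklore] -/
def solD (a y t : ℝ) : ℂ :=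
  2 * Complex.I * ((a * Real.exp t : ℝ) : ℂ) / (y : ℂ) *
      (polyaG 0 (a * Real.exp t) y * polyaG 1 (a * Real.exp t) 0 -
        polyaG 1 (a * Real.exp t) y * polyaG 0 (a * Real.exp t) 0) /
    polyaG 0 (a * Real.exp t) 0 ^ 2

/-! ### The witness sequence of chains -/

/-- Horizon of chain `k` in logarithmic time: `T_k = log(k + 2)` (so `e^{T_k} = k + 2`). [folklore] -/
def horizon (k : ℕ) : ℝ :=
  Real.log (k + 2)

/-- Number of bonds of chain `k`: `N_k = (k + 2)^5` (sites `0, …, N_k`). [folklore] -/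
def nBonds (k : ℕ) : ℕ :=
  (k + 2) ^ 5

/-- Mesh (= the uniform weight) of chain `k`: `η_k = T_k / N_k`; `η_k T_k e^{2T_k} → 0`. [folklore] -/
def mesh (k : ℕ) : ℝ :=
  horizon k / nBonds k

/-- Logarithmic time of site `m` of chain `k`: `t_m = (N_k − m) η_k` (site `0` is the far end
`t = T_k`, site `N_k` is `t = 0`; meaningful for `m ≤ N_k`). [folklore] -/
def siteTime (k m : ℕ) : ℝ :=
  ((nBonds k : ℝ) - m) * mesh k

/-- Bond parameter `c_m = tanh K_m = exp(−2 η_k r_a(t_{m+1})) ∈ (0, 1)` of the bond between sites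
`m` and `m + 1` of chain `k`: the chain is the two-state Markov chain with flip probability
`(1 − c_m)/2`. [folklore] -/
def bondTanh (a : ℝ) (k m : ℕ) : ℝ :=
  Real.exp (-(2 * mesh k * flipRate a (siteTime k (m + 1))))

/-- The (ferromagnetic, `≥ 0`) coupling of bond `m` of chain `k`: `K_m = artanh c_m`. [folklore] -/
def chainK (a : ℝ) (k m : ℕ) : ℝ :=
  couplingOfTanh (bondTanh a k m)

/-! ### Pólya's kernel law -/

/-- The law `∝ e^{−a cosh(κ u)} du` on `ℝ` as a measure: `(∫ k)⁻¹ · k du` with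
`k u = polyaKernel 0 a (κ u) = e^{−a cosh(κu)}` (a probability measure for `a, κ > 0`). [folklore] -/
def kernelMeasure (a κ : ℝ) : Measure ℝ :=
  (∫⁻ u, ENNReal.ofReal (polyaKernel 0 a (κ * u)))⁻¹ •
    volume.withDensity fun u => ENNReal.ofReal (polyaKernel 0 a (κ * u))

end Summit.RiemannHypothesis.RiemannHypothesis.Theorems.LeeYangTelegraph

end
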